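import Mathlib.Algebra.BigOperators.Group.Finset.Basic
import Mathlib.Algebra.BigOperators.Intervals
import Mathlib.Order.Interval.Finset.Nat
import Mathlib.Algebra.Order.Ring.Abs
import Mathlib.Algebra.Ring.Parity
import Mathlib.Order.Monotone.Basic
import Mathlib.Tactic.Linarith
import Mathlib.Tactic.NormNum
import Mathlib.Tactic.Ring
import Mathlib.Tactic.Positivity
import HarnessLib

/-!
# The (0,1) cell of the ι-window, XLIV: the product ground `B₁ × B₂`, XXXI — THE CORNER XVI (report [XLIV] `H2-ZERO-ONE-44.md`):
# LEMMA PARITY-RUN (the Lefschetz term of THICK-SOCLE is paid for by pole growth at the Weierstrass points), LEMMA SUPPORT,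
# the excess sequence at a double pole of `Φ₂`, and the reflection identity of the local pairing

Family `hodge`, b2b cell `hweil` (helper of item stmt-HodgeConjecture-2524). Report
`run/shared/lean/b2b/hodge-weil/b2b-hweil-pv1-g56/H2-ZERO-ONE-44.md` ([XLIV]). Context (the report's words, nothing of them formalised beyond what is
stated): in THEOREM THICK-SOCLE ([XLI] 4.1) the socle count of a balanced thick line carries a Lefschetz term
`L_i = (−1)^i (f′_i − f″_i)`, `f′_i = #{w : k′_i(w) odd}`, `f″_i = #{w : k″_i(w) odd}` over the six Weierstrass points `w` of `Γ`, where
`k′_j(w) ≤ k″_j(w)` are the (non-decreasing in `j`) pole orders of the 1-part and t̄-part layers at `w`. [XLIII] §7 left `L_i ∈ [−6, 6]` free and found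
the census LP void. [XLIV] computes `L` from the local sequences: (i) LEMMA SUPPORT — a point contributes to `L_i` only if `k′_i(w) ≢ k″_i(w) (mod 2)`,
so only if the intercept `k″_i(w) − k′_i(w)` is odd (`≥ 1`); (ii) LEMMA PARITY-RUN — for a non-decreasing sequence `k`, twice the alternating sum
`Σ_{m ≤ i ≤ m+d} (−1)^i [k_i odd]` is bounded in absolute value by `k_{m+d} − k_m + [k_m odd] + [k_{m+d} odd]`: a sustained Lefschetz discount costs
pole growth; (iii) at a double pole of `Φ₂` the excess `e_j := k″_j − j` obeys the growth law of [XLIII] THEOREM QUADRATIC t-GROWTH with `a = 0`, and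
minimal growth gives no discount; (iv) under the local pairing `k′_i + k″_{b−1−i} = k″_{b−1} ≡ b + 1 (mod 2)` ([XLI] 3.1, 3.5) the contribution of
layer `i` is antisymmetric under `i ↦ b − 1 − i`. (i)–(iv) are proved below as statements about integer sequences (PARITY-RUN in full generality);
they claim no geometry. HONEST FRAMING: census work inside the ladder's H2 test ((0,1) cell) on the SPECIAL fourfold `X₀`; nothing here is a rung;
no case of the Hodge conjecture is proved; no statement of [Markman 2025] / [Perry 2026] / [EdGFS 2025] is used.
-/

-- mandated namespace `Summit.HodgeConjecture.HodgeConjecture.…` (Problem = Summit) trips `linter.dupNamespace`; the lakefile disables it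
-- tree-wide (weak option), restated here so stand-alone elaboration is warning-free too.
set_option linter.dupNamespace false

open Finset

namespace Summit.HodgeConjecture.HodgeConjecture.WeilTypeLadder

section ProductGroundThirtyOne

/-- **[XLIV] 2.1 (LEMMA SUPPORT, the arithmetic).** A Weierstrass point contributes to `L_i = (−1)^i([k′_i odd] − [k″_i odd])` only when the
two parities differ; with `k′_i ≤ k″_i` this forces the intercept `ι_i = k″_i − k′_i` to be odd, in particular `≥ 1` (so, by [XLII] PSI-REGULAR, the
point is a pole of `Ψ`), and the contribution is `±1`. [`omega`] -/
theorem pg31_support (k1 k2 : ℕ) (hle : k1 ≤ k2) (hpar : k1 % 2 ≠ k2 % 2) :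
    1 ≤ k2 - k1 ∧ (k2 - k1) % 2 = 1 ∧
      ((((k1 % 2 : ℕ) : ℤ) - ((k2 % 2 : ℕ) : ℤ) = 1) ∨ (((k1 % 2 : ℕ) : ℤ) - ((k2 % 2 : ℕ) : ℤ) = -1)) := by
  refine ⟨by omega, by omega, by omega⟩

/-- **[XLIV] 2.2 (LEMMA PARITY-RUN, the inductive invariant — proved in full).** For a non-decreasing `k : ℕ → ℕ` write `χ(v) = v % 2` and
`S(m, n) = Σ_{m ≤ i < n} (−1)^i χ(k_i)`. Then for all `m, d`:
`|2 S(m, m+d+1) − (−1)^{m+d} χ(k_{m+d}) − (−1)^m χ(k_m)| ≤ k_{m+d} − k_m`.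
(Within a run of constant value the quantity `2S − (−1)^{last} χ(last)` is constant; at a change of value it moves by
`|χ(new) − χ(old)| ≤ new − old`.) [induction on `d`; `nlinarith`] -/
theorem pg31_parity_run_invariant (k : ℕ → ℕ) (hk : Monotone k) (m : ℕ) :
    ∀ d : ℕ, |2 * (∑ i ∈ Finset.Ico m (m + d + 1), (-1 : ℤ) ^ i * ((k i % 2 : ℕ) : ℤ))
        - (-1 : ℤ) ^ (m + d) * ((k (m + d) % 2 : ℕ) : ℤ) - (-1 : ℤ) ^ m * ((k m % 2 : ℕ) : ℤ)| ≤ (k (m + d) : ℤ) - k m := by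
  intro d
  induction d with
  | zero =>
    rw [show m + 0 = m from rfl]
    simp only [Nat.Ico_succ_singleton, Finset.sum_singleton]
    ring_nf; simp
  | succ d ih =>
    rw [show m + (d + 1) = m + d + 1 from by ring]
    have hstep : (∑ i ∈ Finset.Ico m (m + d + 1 + 1), (-1 : ℤ) ^ i * ((k i % 2 : ℕ) : ℤ))
        = (∑ i ∈ Finset.Ico m (m + d + 1), (-1 : ℤ) ^ i * ((k i % 2 : ℕ) : ℤ)) + (-1 : ℤ) ^ (m + d + 1) * ((k (m + d + 1) % 2 : ℕ) : ℤ) :=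
      Finset.sum_Ico_succ_top (by omega) _
    have hmono : k (m + d) ≤ k (m + d + 1) := hk (by omega)
    have hchi : |(((k (m + d + 1)) % 2 : ℕ) : ℤ) - (((k (m + d)) % 2 : ℕ) : ℤ)| ≤ ((k (m + d + 1) : ℕ) : ℤ) - ((k (m + d) : ℕ) : ℤ) := by
      rcases Nat.lt_or_ge (k (m + d)) (k (m + d + 1)) with hlt | hge
      · have h1 := Nat.mod_lt (k (m + d)) (by norm_num : 0 < 2); have h2 := Nat.mod_lt (k (m + d + 1)) (by norm_num : 0 < 2)
        rw [abs_le]; constructor <;> omega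
      · have : k (m + d) = k (m + d + 1) := le_antisymm hmono hge
        rw [this]; simp
    have hpow : (-1 : ℤ) ^ (m + d + 1) = - (-1 : ℤ) ^ (m + d) := by rw [pow_succ]; ring
    rw [hstep, hpow]
    have hu : (-1 : ℤ) ^ (m + d) = 1 ∨ (-1 : ℤ) ^ (m + d) = -1 := by
      rcases Nat.even_or_odd (m + d) with he | ho
      · left; exact Even.neg_one_pow he
      · right; exact Odd.neg_one_pow ho
    have hcast : ((k (m + d + 1) : ℕ) : ℤ) - k m = ((k (m + d) : ℤ) - k m) + ((k (m + d + 1) : ℤ) - k (m + d)) := by ring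
    rw [hcast]
    rw [abs_le] at ih hchi ⊢
    rcases hu with h1 | h1 <;> rw [h1] at ih ⊢ <;> constructor <;> nlinarith [ih.1, ih.2, hchi.1, hchi.2]

/-- **[XLIV] 2.2 (COROLLARY PARITY-RUN).** For a non-decreasing `k : ℕ → ℕ`:
`2 |Σ_{m ≤ i ≤ m+d} (−1)^i χ(k_i)| ≤ (k_{m+d} − k_m) + χ(k_m) + χ(k_{m+d}) ≤ k_{m+d} − k_m + 2` — the alternating parity sum of a monotone
sequence is at most half its total increase plus one: a Weierstrass point that feeds the Lefschetz term `−1` per layer over `[m, m+d]` must raise its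
pole order by `≈ 2` per layer there. [from the invariant; `nlinarith`] -/
theorem pg31_parity_run_bound (k : ℕ → ℕ) (hk : Monotone k) (m d : ℕ) :
    2 * |∑ i ∈ Finset.Ico m (m + d + 1), (-1 : ℤ) ^ i * ((k i % 2 : ℕ) : ℤ)|
        ≤ ((k (m + d) : ℤ) - k m) + ((k m % 2 : ℕ) : ℤ) + ((k (m + d) % 2 : ℕ) : ℤ) ∧
      2 * |∑ i ∈ Finset.Ico m (m + d + 1), (-1 : ℤ) ^ i * ((k i % 2 : ℕ) : ℤ)| ≤ ((k (m + d) : ℤ) - k m) + 2 := by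
  have h := pg31_parity_run_invariant k hk m d
  have c1 : (0 : ℤ) ≤ ((k m % 2 : ℕ) : ℤ) := by positivity
  have c2 : (0 : ℤ) ≤ ((k (m + d) % 2 : ℕ) : ℤ) := by positivity
  have d1 : ((k m % 2 : ℕ) : ℤ) ≤ 1 := by have := Nat.mod_lt (k m) (by norm_num : 0 < 2); omega
  have d2 : ((k (m + d) % 2 : ℕ) : ℤ) ≤ 1 := by have := Nat.mod_lt (k (m + d)) (by norm_num : 0 < 2); omega
  have hu : ((-1 : ℤ) ^ (m + d) = 1 ∨ (-1 : ℤ) ^ (m + d) = -1) ∧ ((-1 : ℤ) ^ m = 1 ∨ (-1 : ℤ) ^ m = -1) := by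
    constructor
    · rcases Nat.even_or_odd (m + d) with he | ho
      · left; exact Even.neg_one_pow he
      · right; exact Odd.neg_one_pow ho
    · rcases Nat.even_or_odd m with he | ho
      · left; exact Even.neg_one_pow he
      · right; exact Odd.neg_one_pow ho
  have e : 2 * |∑ i ∈ Finset.Ico m (m + d + 1), (-1 : ℤ) ^ i * ((k i % 2 : ℕ) : ℤ)|
      = |2 * ∑ i ∈ Finset.Ico m (m + d + 1), (-1 : ℤ) ^ i * ((k i % 2 : ℕ) : ℤ)| := by
    rw [abs_mul]; simp
  rw [e, abs_le, abs_le]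
  rw [abs_le] at h
  rcases hu with ⟨h1 | h1, h2 | h2⟩ <;> rw [h1, h2] at h <;> refine ⟨⟨?_, ?_⟩, ?_, ?_⟩ <;> nlinarith [h.1, h.2]

/-- **[XLIV] 2.4 (LEMMA EIGHT, the bookkeeping).** THICK-SOCLE gives `Σ_{i=2}^{j}(10 − s_i) ≤ ε₀ + D` with `D = −Σ L_i`; COROLLARY LEFSCHETZ-COST gives
`2D ≤ 24 + W′ + W″` with `W′ = Σ_w k′_j(w) ≤ d′_j`, `W″ = Σ_w k″_j(w) ≤ d″_j` (the layer-2 terms dropped, `k ≥ 0`); with `d = ℓ + 2j`: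
`2 Σ_{i=2}^{j} s_i + (ℓ′_j + ℓ″_j) ≥ 16 j − 44 − 2 ε₀` — mean layer thickness at least `8` asymptotically. [`linarith`] -/
theorem pg31_eight (j : ℕ) (ε₀ D W1 W2 d1 d2 l1 l2 Ssum : ℤ)
    (hsoc : 10 * ((j : ℤ) - 1) - Ssum ≤ ε₀ + D) (hrun : 2 * D ≤ 24 + W1 + W2) (h1 : W1 ≤ d1) (h2 : W2 ≤ d2)
    (hd1 : d1 = l1 + 2 * j) (hd2 : d2 = l2 + 2 * j) :
    2 * Ssum + (l1 + l2) ≥ 16 * (j : ℤ) - 44 - 2 * ε₀ := by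
  subst hd1; subst hd2; linarith

/-- **[XLIV] 3.1 (LEMMA LOCAL PAIRING, the degree bookkeeping).** With `d′_j = ℓ′_j + 2j`, `d″_j = ℓ″_j + 2j`, the pairing `ℓ′_j + ℓ″_{b−1−j} = 10 + c_j` and
TOP `ℓ″_{b−1} = 10 + c_0`: the total pairing defect `Σ_p δ_j(p) = d″_{b−1} − d′_j − d″_{b−1−j}` equals `c_0 − c_j`; and if the defect splits as a Weierstrass part
`DW ≥ 0` plus a residual part `DR ≥ 0`, then `DW ≤ c_0 − c_j`. [`linarith`] -/
theorem pg31_local_pairing (b j : ℕ) (l1j l2m l2top c0 cj DW DR : ℤ)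
    (hpair : l1j + l2m = 10 + cj) (htop : l2top = 10 + c0) :
    (l2top + 2 * ((b : ℤ) - 1)) - (l1j + 2 * (j : ℤ)) - (l2m + 2 * ((b : ℤ) - 1 - j)) = c0 - cj ∧
    ((l2top + 2 * ((b : ℤ) - 1)) - (l1j + 2 * (j : ℤ)) - (l2m + 2 * ((b : ℤ) - 1 - j)) = DW + DR → 0 ≤ DR → DW ≤ c0 - cj) := by
  refine ⟨by linarith, fun h hR => by linarith⟩

/-- **[XLIV] 3.2 (the excess sequence at a double pole of `Φ₂`).** At a Weierstrass point with `a(w) = 2` write `k″_j = j + e_j`. (a) THEOREM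
QUADRATIC t-GROWTH `k″_{2i+1} ≥ k″_i + k″_{i−1} + 2` becomes `e_{2i+1} ≥ e_i + e_{i−1}` (the law with `a = 0`), and GROWTH `k″_{j+2} ≥ k″_j + 2`
becomes `e_{j+2} ≥ e_j`. (b) A constant excess `e ≡ c` on `{i−1, i, 2i+1}` forces `c ≤ 0`; with the forced 1-part `k″_{2m} ≥ k′_{2m} ≥ 2m` (the powers
of `Φ₂`), `c ≥ 0`: minimal growth `k″_j = j` exactly, whose parity is that of `j` — such a point feeds the Lefschetz term `+⌊(j−1)/2⌋`, never a
discount (c). [`omega`/`linarith`] -/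
theorem pg31_double_pole_excess :
    (∀ e : ℕ → ℤ, ∀ i : ℕ, 1 ≤ i →
        ((2 * i + 1 : ℤ) + e (2 * i + 1) ≥ ((i : ℤ) + e i) + (((i : ℤ) - 1) + e (i - 1)) + 2 ↔ e (2 * i + 1) ≥ e i + e (i - 1))) ∧
    (∀ c : ℤ, c ≥ c + c → c ≤ 0) ∧
    (∀ c : ℤ, ∀ m : ℕ, (2 * m : ℤ) + c ≥ 2 * m → 0 ≤ c) ∧
    (∀ j : ℕ, ((j % 2 : ℕ) : ℤ) = if j % 2 = 1 then 1 else 0) := by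
  refine ⟨fun e i hi => ?_, fun c h => by linarith, fun c m h => by linarith, fun j => ?_⟩
  · have : ((i - 1 : ℕ) : ℤ) = (i : ℤ) - 1 := by omega
    constructor <;> intro h <;> linarith
  · split_ifs with h
    · simp [h]
    · have : j % 2 = 0 := by omega
      simp [this]

/-- **[XLIV] 3.3 (LEMMA REFLECTION, the reflection identity of the local pairing).** At a Weierstrass point outside `Γ ∩ W″` the local pairing is perfect:
`k′_i + k″_{b−1−i} = T := k″_{b−1}` for all `i`, and `T ≡ b + 1 (mod 2)` (TRACELESS, [XLI] 3.5). Writing `k″_j = j + e_j`, the contribution of layer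
`i` to the Lefschetz term, `(−1)^i([k′_i odd] − [k″_i odd])`, equals `[e_{b−1−i} odd] − [e_i odd]`: it is ANTISYMMETRIC under `i ↦ b − 1 − i`, so
the total over `2 ≤ i ≤ b − 3` vanishes and the partial sums are `#{i ≤ j : e_{b−1−i} odd} − #{i ≤ j : e_i odd}`. (Stated for the two parities of `i`
separately; all quantities natural numbers, `i ≤ b − 1`.) [`omega`] -/
theorem pg31_reflection (b T i k1 k2i k2r ei er : ℕ) (hi : i + 1 ≤ b) (hpair : k1 + k2r = T) (hT : T % 2 = (b + 1) % 2)
    (hk2i : k2i = i + ei) (hk2r : k2r = (b - 1 - i) + er) :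
    (i % 2 = 0 → ((k1 % 2 : ℕ) : ℤ) - ((k2i % 2 : ℕ) : ℤ) = ((er % 2 : ℕ) : ℤ) - ((ei % 2 : ℕ) : ℤ)) ∧
    (i % 2 = 1 → -( ((k1 % 2 : ℕ) : ℤ) - ((k2i % 2 : ℕ) : ℤ) ) = ((er % 2 : ℕ) : ℤ) - ((ei % 2 : ℕ) : ℤ)) := by
  constructor <;> intro hpi <;> omega

/-- **[XLIV] 4.4 (LEMMA FE — the functional equation in valuations — and COROLLARY FLAT-DOUBLING, the bookkeeping).** CASE A of LEMMA FE
(`k″_j + a > k′_{j+2}`) gives `k̃′_{j+1} + k̃′_{j+2} = k″_j + k″_{j+1} + a`; DEFECT at `j + 1` gives `k̃′_{j+2} ≤ k′_{j+2} + k″_{j+1} − k′_{j+1}`; hence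
(a) `k̃′_{j+1} ≥ k″_j + a + k′_{j+1} − k′_{j+2}`; with E·Q̃ (`k″_{2j+1} ≥ k″_j + k̃′_{j+1}`): (b) `k″_{2j+1} ≥ 2 k″_j + a − (k′_{j+2} − k′_{j+1})` — on a FLAT stretch of
the 1-part (`k′_{j+1} = k′_{j+2}`) the t̄-part DOUBLES: `k″_{2j+1} ≥ 2k″_j + a`; (c) the numerical instance that kills the surviving local pattern of the v1/v2
census witnesses (`a = 0`, `k′ ≡ 0`, `k″_3 = 2`, `k″_7 = 3`): `3 ≥ 4` is false. [`linarith`/`omega`] -/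
theorem pg31_fe_flat_doubling :
    (∀ kh1 kh2 k2j k2j1 a k1j1 k1j2 : ℤ,
        kh1 + kh2 = k2j + k2j1 + a → kh2 ≤ k1j2 + k2j1 - k1j1 → kh1 ≥ k2j + a + k1j1 - k1j2) ∧
    (∀ kh1 k2j k2odd a k1j1 k1j2 : ℤ,
        k2odd ≥ k2j + kh1 → kh1 ≥ k2j + a + k1j1 - k1j2 → k2odd ≥ 2 * k2j + a - (k1j2 - k1j1)) ∧
    (∀ k2j k2odd a : ℤ, ∀ k1 : ℤ, k2odd ≥ 2 * k2j + a - (k1 - k1) → k2odd ≥ 2 * k2j + a) ∧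
    ¬ ((3 : ℤ) ≥ 2 * 2 + 0) := by
  refine ⟨fun kh1 kh2 k2j k2j1 a k1j1 k1j2 h1 h2 => by linarith, fun kh1 k2j k2odd a k1j1 k1j2 h1 h2 => by linarith,
    fun k2j k2odd a k1 h => by linarith, by norm_num⟩

/-- **[XLIV] 3.5 (LEMMA ODD-FIBRE, the parity count).** The vertical part of `D′ ⊂ S` is an ι-stable effective divisor `Σ_a m_a·({a} × C₂)` of degree
`v′ = 7` on `Θ`; the points `a ∉ Θ[2]` come in ι-orbits `{a, −a}` with equal multiplicities, so their total `e` is even, and the six 2-torsion points carry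
multiplicities `m₁, …, m₆` with `e + Σ m_i = 7`. Hence some `m_i` is odd (in particular `≥ 1`): at least one vertical fibre unit of `W′` lies over a Weierstrass
point of `Θ`, so for every `z` at least one Weierstrass point of `Γ_z` lies in `Γ_z ∩ W″` (`n_T ≥ 1`). [`omega`] -/
theorem pg31_odd_fibre (e m1 m2 m3 m4 m5 m6 : ℕ) (he : e % 2 = 0) (hsum : e + m1 + m2 + m3 + m4 + m5 + m6 = 7) :
    m1 % 2 = 1 ∨ m2 % 2 = 1 ∨ m3 % 2 = 1 ∨ m4 % 2 = 1 ∨ m5 % 2 = 1 ∨ m6 % 2 = 1 := by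
  omega

/-- **[XLIV] 6.3 (THEOREM N2-REFUTED, the arithmetic of one counterexample).** [XLIII] 2.6 (a)'s computed law N2 — `k″_{i+j+2} ≥ k″_i + k″_j + a` at
every point with `π = 0` — is FALSE: the kit sweep j180681 (59 069 lattices, 3 161 812 instances) found 7 violating instances in 5 lattices, each re-verified at a
larger truncation. Lattice (4) (seed 560103 #7161; `a = 0`) has t̄-layers `k″ = 0,0,0,0,0,4,4,4,6,6,6,8,8,8,8,8,12,12,12,12` and violates N2 at `(i, j) = (8, 5)`:
`k″_15 = 8 < k″_8 + k″_5 + a = 6 + 4 + 0`; the same sequence satisfies THEOREM QUADRATIC t-GROWTH (N1) at every `i` with `2i + 1 ≤ 19` (as it must). The data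
are transcribed here; `decide` checks both facts on them. (Companion to [XLIII]'s `pg30_N2_independent`: N2 is not only independent of N1 — it is false.) -/
theorem pg31_N2_refuted_instance :
    let k : ℕ → ℕ := fun n => [0, 0, 0, 0, 0, 4, 4, 4, 6, 6, 6, 8, 8, 8, 8, 8, 12, 12, 12, 12].getD n 0
    ¬ (k 15 ≥ k 8 + k 5 + 0) ∧ (∀ i ∈ Finset.Icc 1 9, k (2 * i + 1) ≥ k i + k (i - 1) + 0) := by
  decide

end ProductGroundThirtyOne

end Summit.HodgeConjecture.HodgeConjecture.WeilTypeLadder
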